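import Mathlib
import HarnessLib
import Summits.KontsevichZagierPeriods.KontsevichZagierPeriods.Theorems.ResidualBeyondGenusZero.Negative.LoadBearing

/-!
# Route LinRedNormalForm, item `ResidualBeyondGenusZero` (stmt-KontsevichZagierPeriods-3917): the splice (tenure-split) glue

`ResidualBeyondGenusZero` is the DECLARED RESIDUAL of route LinRedNormalForm — summit-strength off
the genus-zero sector (`LinRedNormalFormResidualBeyondGenusZeroStrength.lean`) and held, to be
revisited only by a TENURE SPLIT "RES ⇐ (next-sector normal form) → (next-sector kernel) →
(smaller residual)" (route file, RANKED CRUXES #8; planner hold 2026-08-16). This file proves that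
glue once and for all, generically in the next sector, so that such a split can be filed with a
`provable-now` glue item and so that its three antecedents are stated in exactly the shape that
composes:

* `ker_le_sup_closure_of_splice` — ABSTRACT LATTICE FORM. In an abelian group with an additive
  "evaluation" `e` and a subgroup of relations `R ≤ ker e` (soundness), if
  (smaller residual) `ker e ≤ R ⊔ ⟨S ∪ T⟩`, (normal form) `T ⊆ R ⊔ ⟨S ∪ N⟩`, and
  (RELATIVE kernel) `⟨S ∪ N⟩ ⊓ ker e ≤ R ⊔ ⟨S⟩`, then `ker e ≤ R ⊔ ⟨S⟩`.
* `residualBeyondGenusZero_of_splice` — the same for the KZ calculus with `S = Negative.gzSet`, the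
  genus-zero representations (`Negative.gzSet_eq`: on the nose the set inlined in the route decl;
  `Negative.residual_iff`), `T` = the generators of a further
  sector (e.g. genus-one iterated integrals, Γ-corner representations), `N` = that sector's normal
  forms: RES follows from the residual over `GZ ∪ T`, a move-level normal form of every
  `T`-generator inside `⟨GZ ∪ N⟩`, and the kernel of `eval` on `⟨GZ ∪ N⟩` MODULO genus zero.
* `residualBeyondGenusZero_of_splice_of_kernel` — variant with the ABSOLUTE next-sector kernel
  `⟨GZ ∪ N⟩ ⊓ ker eval ≤ relations` (stronger hypothesis, `c₀ := 0`).
* `splice_hypotheses_of_residualBeyondGenusZero` — conversely RES gives back the smaller residual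
  and the relative kernel for every `T`, `N` (so of the three antecedents only the normal form
  carries content beyond RES, exactly as `DihedralNormalForm` does in the route's `Assembly`).

Why the RELATIVE kernel is the right middle item: an absolute kernel on `⟨N⟩` alone does not
compose (a vanishing combination mixing genus-zero and `N`-classes need not split into two
vanishing ones), while the absolute kernel on `⟨GZ ∪ N⟩` contains the genus-zero kernel
(`MzvKernelInKZ`-strength) a second time; the relative form asks only for the new sector's
relations modulo the old one.

References: M. Kontsevich, D. Zagier, *Periods* (2001), §1.2, Conjecture 1; A. Huber,
S. Müller-Stach, *Periods and Nori Motives* (2017), Conj. 13.2.1 (kernel form).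
-/

noncomputable section

namespace Summit.KontsevichZagierPeriods.ResidualBeyondGenusZero

open Literature.NumberTheory.Transcendental
open Summit.KontsevichZagierPeriods.KontsevichZagierPeriods.Theses.LinRedNormalForm

/-- **Splice lemma, abstract lattice form.** Let `e : M →+ B` be additive, `R ≤ ker e` a subgroup
("relations are sound"), and `S T N ⊆ M`. If `ker e ≤ R ⊔ closure (S ∪ T)` (residual over the
larger generator set), `T ⊆ R ⊔ closure (S ∪ N)` (every new generator has a normal form) and
`closure (S ∪ N) ⊓ ker e ≤ R ⊔ closure S` (kernel on the normal forms, relative to `S`), then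
`ker e ≤ R ⊔ closure S`. Proof: `closure (S ∪ T) ≤ R ⊔ closure (S ∪ N)` by `closure_le`, so a
`c ∈ ker e` is `y + z` with `y ∈ R`, `z ∈ closure (S ∪ N)`; soundness gives `e z = e c - e y = 0`,
the relative kernel gives `z ∈ R ⊔ closure S`, and `R ⊔ closure S` is a subgroup. [folklore] -/
theorem ker_le_sup_closure_of_splice {M B : Type} [AddCommGroup M] [AddCommGroup B]
    (e : M →+ B) (R : AddSubgroup M) (hR : R ≤ e.ker) (S T N : Set M)
    (hRes : e.ker ≤ R ⊔ AddSubgroup.closure (S ∪ T))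
    (hNF : T ⊆ ↑(R ⊔ AddSubgroup.closure (S ∪ N)))
    (hKer : AddSubgroup.closure (S ∪ N) ⊓ e.ker ≤ R ⊔ AddSubgroup.closure S) :
    e.ker ≤ R ⊔ AddSubgroup.closure S := by
  have hST : AddSubgroup.closure (S ∪ T) ≤ R ⊔ AddSubgroup.closure (S ∪ N) := by
    rw [AddSubgroup.closure_le]
    rintro x (hx | hx)
    · exact AddSubgroup.mem_sup_right (AddSubgroup.subset_closure (Or.inl hx))
    · exact hNF hx
  have hker : e.ker ≤ R ⊔ AddSubgroup.closure (S ∪ N) :=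
    hRes.trans (sup_le le_sup_left hST)
  intro c hc
  obtain ⟨y, hy, z, hz, hyz⟩ := AddSubgroup.mem_sup.1 (hker hc)
  have hzker : z ∈ e.ker := by
    have hc' : e c = 0 := (AddMonoidHom.mem_ker).1 hc
    have hy' : e y = 0 := (AddMonoidHom.mem_ker).1 (hR hy)
    rw [← hyz, map_add, hy', zero_add] at hc'
    exact (AddMonoidHom.mem_ker).2 hc'
  have hz' : z ∈ R ⊔ AddSubgroup.closure S := hKer ⟨hz, hzker⟩
  rw [← hyz]
  exact add_mem (AddSubgroup.mem_sup_left hy) hz'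

/-- Elementwise repackaging of `K ≤ R ⊔ closure S` for a kernel: `ker e ≤ R ⊔ closure S` iff every
`c` with `e c = 0` is congruent modulo `R` to an element of `closure S`. [folklore] -/
theorem ker_le_sup_closure_iff {M B : Type} [AddCommGroup M] [AddCommGroup B]
    (e : M →+ B) (R : AddSubgroup M) (S : Set M) :
    e.ker ≤ R ⊔ AddSubgroup.closure S ↔
      ∀ c, e c = 0 → ∃ c₀ ∈ AddSubgroup.closure S, c - c₀ ∈ R := by
  constructor
  · intro hle c hc
    obtain ⟨y, hy, z, hz, hyz⟩ := AddSubgroup.mem_sup.1 (hle ((AddMonoidHom.mem_ker).2 hc))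
    refine ⟨z, hz, ?_⟩
    rwa [← hyz, add_sub_cancel_right]
  · intro h c hc
    obtain ⟨c₀, hc₀, hcc₀⟩ := h c ((AddMonoidHom.mem_ker).1 hc)
    exact AddSubgroup.mem_sup.2 ⟨c - c₀, hcc₀, c₀, hc₀, sub_add_cancel c c₀⟩

/-- **Splice (tenure-split glue) for the declared residual.** Write `GZ = Negative.gzSet` for the
genus-zero generator set (equal on the nose to the set inlined in the route decl,
`Negative.gzSet_eq`). Let `T` be the generator set of a further sector (any set of formal
representations) and `N` its set of normal forms. Then
`ResidualBeyondGenusZero` follows from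
(i) the SMALLER RESIDUAL over `GZ ∪ T`: every vanishing combination is congruent modulo
`KZ.relations` to a `ℤ`-combination of genus-zero and `T`-representations;
(ii) the NEXT-SECTOR NORMAL FORM: every `x ∈ T` is congruent modulo `KZ.relations` to an element
of `closure (GZ ∪ N)`;
(iii) the NEXT-SECTOR KERNEL RELATIVE TO GENUS ZERO: every vanishing element of `closure (GZ ∪ N)`
is congruent modulo `KZ.relations` to an element of `closure GZ`.
The only analytic input is soundness `KZ.relations ≤ ker eval` (`KZ.relations_le_ker_eval_holds`);
the rest is `ker_le_sup_closure_of_splice`. With `T = N = ∅`-content this is the identity; with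
`T` = genus-one iterated-integral representations it is the glue by which routes GenusOneIterated /
Grothendieck / AyoubSpecialisation attach to this item (route file, RANKED CRUXES #8). [folklore] -/
theorem residualBeyondGenusZero_of_splice (T N : Set KZ.FormalRep)
    (hRes : ∀ c : KZ.FormalRep, KZ.eval c = 0 →
      ∃ c₁ ∈ AddSubgroup.closure (Negative.gzSet ∪ T), c - c₁ ∈ KZ.relations)
    (hNF : ∀ x ∈ T, ∃ m ∈ AddSubgroup.closure (Negative.gzSet ∪ N), x - m ∈ KZ.relations)
    (hKer : ∀ m ∈ AddSubgroup.closure (Negative.gzSet ∪ N), KZ.eval m = 0 →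
      ∃ c₀ ∈ AddSubgroup.closure Negative.gzSet, m - c₀ ∈ KZ.relations) :
    ResidualBeyondGenusZero := by
  rw [Negative.residual_iff, ← ker_le_sup_closure_iff]
  refine ker_le_sup_closure_of_splice KZ.eval KZ.relations KZ.relations_le_ker_eval_holds _ T N
    ((ker_le_sup_closure_iff _ _ _).2 hRes) ?_ ?_
  · intro x hx
    obtain ⟨m, hm, hxm⟩ := hNF x hx
    exact AddSubgroup.mem_sup.2 ⟨x - m, hxm, m, hm, sub_add_cancel x m⟩
  · rintro m ⟨hm, hm0⟩
    obtain ⟨c₀, hc₀, hmc₀⟩ := hKer m hm ((AddMonoidHom.mem_ker).1 hm0)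
    exact AddSubgroup.mem_sup.2 ⟨m - c₀, hmc₀, c₀, hc₀, sub_add_cancel m c₀⟩

/-- **Splice with an absolute next-sector kernel.** As `residualBeyondGenusZero_of_splice`, but
with (iii) replaced by the stronger ABSOLUTE kernel on the joint sector: every vanishing element of
`closure (GZ ∪ N)` lies in `KZ.relations` (take `c₀ := 0`). This is the shape of the route's own
`Assembly` one sector up (there `T = GZ`-complement is everything, `N` = MZV word representations,
and the kernel is `MzvKernelInKZ`). [folklore] -/
theorem residualBeyondGenusZero_of_splice_of_kernel (T N : Set KZ.FormalRep)
    (hRes : ∀ c : KZ.FormalRep, KZ.eval c = 0 →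
      ∃ c₁ ∈ AddSubgroup.closure (Negative.gzSet ∪ T), c - c₁ ∈ KZ.relations)
    (hNF : ∀ x ∈ T, ∃ m ∈ AddSubgroup.closure (Negative.gzSet ∪ N), x - m ∈ KZ.relations)
    (hKer : ∀ m ∈ AddSubgroup.closure (Negative.gzSet ∪ N), KZ.eval m = 0 → m ∈ KZ.relations) :
    ResidualBeyondGenusZero :=
  residualBeyondGenusZero_of_splice T N hRes hNF fun m hm hm0 =>
    ⟨0, zero_mem _, by simpa using hKer m hm hm0⟩

/-- **The split loses nothing but the normal form.** Conversely, `ResidualBeyondGenusZero` implies,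
for every `T` and `N`, the smaller residual (i) (monotonicity of `closure`) and the relative kernel
(iii) (it is the residual restricted to `closure (GZ ∪ N)`); so in a tenure split
RES ⇐ (i) ∧ (ii) ∧ (iii) the antecedents (i) and (iii) are again implied by the summit
(`residualBeyondGenusZero_of_kontsevichZagierPeriods`) and only the normal form (ii) is new
content — the same division of labour as `DihedralNormalForm` / `MzvKernelInKZ` /
`ResidualBeyondGenusZero` in the route's `Assembly`. [folklore] -/
theorem splice_hypotheses_of_residualBeyondGenusZero (h : ResidualBeyondGenusZero)
    (T N : Set KZ.FormalRep) :
    (∀ c : KZ.FormalRep, KZ.eval c = 0 →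
      ∃ c₁ ∈ AddSubgroup.closure (Negative.gzSet ∪ T), c - c₁ ∈ KZ.relations) ∧
    (∀ m ∈ AddSubgroup.closure (Negative.gzSet ∪ N), KZ.eval m = 0 →
      ∃ c₀ ∈ AddSubgroup.closure Negative.gzSet, m - c₀ ∈ KZ.relations) := by
  rw [Negative.residual_iff] at h
  refine ⟨fun c hc => ?_, fun m _ hm => h m hm⟩
  obtain ⟨c₀, hc₀, hcc₀⟩ := h c hc
  exact ⟨c₀, AddSubgroup.closure_mono Set.subset_union_left hc₀, hcc₀⟩

end Summit.KontsevichZagierPeriods.ResidualBeyondGenusZero
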